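import Mathlib.Algebra.BigOperators.Ring.Finset
import Mathlib.Algebra.BigOperators.GroupWithZero.Finset
import Mathlib.Algebra.Order.BigOperators.Ring.Finset
import Mathlib.Algebra.Order.BigOperators.GroupWithZero.Finset
import Mathlib.Data.Finset.Powerset
import Mathlib.Data.Real.Basic
import Mathlib.Tactic.Linarith
import Mathlib.Tactic.Ring
import HarnessLib

/-!
# `NoHeavyLowerTail` (stmt-CriticalPhenomena-4575) — tools for the FOREST (leaf-peeling) certificate: cylinder sums and the sufficiency estimate

Support file (prover `prim-gen-swap` gen 7; `--supports stmt-CriticalPhenomena-4575`).  No definitions, no named facts, no sorries; Mathlib only.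

Algebra over the pattern law `W(σ) = Π_{k∈σ}θ_kΠ_{k∉σ}(1−θ_k)` of independently open stars (`θ ∈ [0,1]^ι`, `ι` linearly ordered = the
leaf-peeling order of the forest certificate, seat memo R3-SEATS.md §9), nested coefficients `c_k = θ_kΠ_{k'<k}(1−θ_{k'})`:
* `StarSet.cylinder_sum` — `Σ_σ W(σ)[O ⊆ σ, Cl ∩ σ = ∅] = Π_Oθ · Π_Cl(1−θ)`; `cylinder_sum_closed`, `cylinder_sum_one_open` — the cases
  `O = ∅` and `O = {i}`;
* `StarSet.prod_one_sub_anti` — `Π_T(1−θ) ≤ Π_S(1−θ)` for `S ⊆ T`;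
* `StarSet.nestedCoeff_partial_lower` — `Σ_{k∈Q} c_k ≥ Π_{k<i,k∉Q}(1−θ_k)·(1 − Π_Q(1−θ))` for `Q ⊆ {k ≤ i}`;
* `StarSet.forest_sufficiency` — the SUFFICIENCY estimate of the charging scheme: for a star `i` with charging set `Q` (`i ∈ Q ⊆ {≤ i}`,
  `Q ∖ i = M ∩ {< i}`), neighbour set `M ∌ i` and port-star set `N ∋ i` with `N ∖ i ⊆ M`:
  `W({i}) ≤ c_i·Π_N(1−θ) + (Σ_{k∈Q}c_k)·θ_iΠ_M(1−θ)` (type A) and `W({i}) ≤ (Σ_{k∈Q}c_k)·Π_M(1−θ)` (type B), division-free.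
-/

namespace Summit.CriticalPhenomena.PercolationContinuityZ3.Theorems

open Finset
open scoped BigOperators

namespace StarSet

variable {ι : Type*} [Fintype ι] [DecidableEq ι]

/-- **Cylinder probabilities of the pattern law.**  For disjoint `O, Cl`:
`Σ_σ W(σ)·[O ⊆ σ, Cl ∩ σ = ∅] = Π_{k∈O}θ_k · Π_{k∈Cl}(1−θ_k)`. [folklore] -/
theorem cylinder_sum (θ : ι → ℝ) (O Cl : Finset ι) (hOC : Disjoint O Cl) :
    ∑ σ ∈ (univ : Finset ι).powerset, ((∏ k ∈ σ, θ k) * ∏ k ∈ univ \ σ, (1 - θ k)) *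
        (if (O ⊆ σ ∧ ∀ k ∈ Cl, k ∉ σ) then (1 : ℝ) else 0) =
      (∏ k ∈ O, θ k) * ∏ k ∈ Cl, (1 - θ k) := by
  -- expand `Π_k (a_k + b_k)` with `a_k = θ_k[k ∉ Cl]`, `b_k = (1−θ_k)[k ∉ O]`
  have hexp := Finset.prod_add (fun k => if k ∈ Cl then (0 : ℝ) else θ k) (fun k => if k ∈ O then (0 : ℝ) else 1 - θ k)
    (univ : Finset ι)
  have hlhs : ∀ σ ∈ (univ : Finset ι).powerset,
      (∏ k ∈ σ, (if k ∈ Cl then (0 : ℝ) else θ k)) * ∏ k ∈ univ \ σ, (if k ∈ O then (0 : ℝ) else 1 - θ k) =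
        ((∏ k ∈ σ, θ k) * ∏ k ∈ univ \ σ, (1 - θ k)) * (if (O ⊆ σ ∧ ∀ k ∈ Cl, k ∉ σ) then (1 : ℝ) else 0) := by
    intro σ _
    by_cases h : O ⊆ σ ∧ ∀ k ∈ Cl, k ∉ σ
    · rw [if_pos h, mul_one]
      congr 1
      · exact prod_congr rfl fun k hk => by rw [if_neg (fun hkC => h.2 k hkC hk)]
      · exact prod_congr rfl fun k hk => by
          rw [if_neg (fun hkO => (Finset.mem_sdiff.1 hk).2 (h.1 hkO))]
    · rw [if_neg h, mul_zero]
      rw [not_and_or] at h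
      rcases h with h | h
      · obtain ⟨k, hkO, hkσ⟩ := Finset.not_subset.1 h
        have hk : k ∈ univ \ σ := Finset.mem_sdiff.2 ⟨mem_univ _, hkσ⟩
        rw [Finset.prod_eq_zero hk (by rw [if_pos hkO]), mul_zero]
      · push Not at h
        obtain ⟨k, hkC, hkσ⟩ := h
        rw [Finset.prod_eq_zero hkσ (by rw [if_pos hkC]), zero_mul]
  rw [← Finset.sum_congr rfl hlhs, ← hexp]
  -- evaluate `Π_k (a_k + b_k)`
  have hO : ∀ k ∈ O, (if k ∈ Cl then (0 : ℝ) else θ k) + (if k ∈ O then (0 : ℝ) else 1 - θ k) = θ k := by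
    intro k hk
    rw [if_neg (Finset.disjoint_left.1 hOC hk), if_pos hk, add_zero]
  have hC : ∀ k ∈ Cl, (if k ∈ Cl then (0 : ℝ) else θ k) + (if k ∈ O then (0 : ℝ) else 1 - θ k) = 1 - θ k := by
    intro k hk
    rw [if_pos hk, if_neg (Finset.disjoint_right.1 hOC hk), zero_add]
  have hrest : ∀ k ∈ univ \ (O ∪ Cl), (if k ∈ Cl then (0 : ℝ) else θ k) + (if k ∈ O then (0 : ℝ) else 1 - θ k) = 1 := by
    intro k hk
    rw [Finset.mem_sdiff, Finset.mem_union, not_or] at hk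
    rw [if_neg hk.2.2, if_neg hk.2.1]; ring
  have hsplit : (univ : Finset ι) = (O ∪ Cl) ∪ (univ \ (O ∪ Cl)) := by
    rw [Finset.union_sdiff_of_subset (subset_univ _)]
  rw [hsplit, Finset.prod_union Finset.disjoint_sdiff, Finset.prod_union hOC, Finset.prod_congr rfl hO, Finset.prod_congr rfl hC,
    Finset.prod_congr rfl hrest, Finset.prod_const_one, mul_one]

/-- Cylinder sum, all-closed case: `Σ_σ W(σ)[Cl ∩ σ = ∅] = Π_{k∈Cl}(1−θ_k)`. [folklore] -/
theorem cylinder_sum_closed (θ : ι → ℝ) (Cl : Finset ι) :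
    ∑ σ ∈ (univ : Finset ι).powerset, ((∏ k ∈ σ, θ k) * ∏ k ∈ univ \ σ, (1 - θ k)) *
        (if (∀ k ∈ Cl, k ∉ σ) then (1 : ℝ) else 0) = ∏ k ∈ Cl, (1 - θ k) := by
  have h := cylinder_sum θ ∅ Cl (Finset.disjoint_empty_left _)
  rw [Finset.prod_empty, one_mul] at h
  rw [← h]
  refine sum_congr rfl fun σ _ => ?_
  congr 1
  exact if_congr (by simp only [Finset.empty_subset, true_and]) rfl rfl

/-- Cylinder sum, one open star: `Σ_σ W(σ)[i ∈ σ, Cl ∩ σ = ∅] = θ_i Π_{k∈Cl}(1−θ_k)` (`i ∉ Cl`). [folklore] -/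
theorem cylinder_sum_one_open (θ : ι → ℝ) (i : ι) (Cl : Finset ι) (hi : i ∉ Cl) :
    ∑ σ ∈ (univ : Finset ι).powerset, ((∏ k ∈ σ, θ k) * ∏ k ∈ univ \ σ, (1 - θ k)) *
        (if (i ∈ σ ∧ ∀ k ∈ Cl, k ∉ σ) then (1 : ℝ) else 0) = θ i * ∏ k ∈ Cl, (1 - θ k) := by
  have h := cylinder_sum θ {i} Cl (Finset.disjoint_singleton_left.2 hi)
  rw [Finset.prod_singleton] at h
  rw [← h]
  refine sum_congr rfl fun σ _ => ?_
  congr 1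
  exact if_congr (by simp only [Finset.singleton_subset_iff]) rfl rfl

omit [Fintype ι] [DecidableEq ι] in
/-- Products of factors `1 − θ_k ∈ [0,1]` are antitone in the index set. [folklore] -/
theorem prod_one_sub_anti (θ : ι → ℝ) (hθ0 : ∀ i, 0 ≤ θ i) (hθ1 : ∀ i, θ i ≤ 1) {S T : Finset ι} (h : S ⊆ T) :
    ∏ k ∈ T, (1 - θ k) ≤ ∏ k ∈ S, (1 - θ k) :=
  Finset.prod_le_prod_of_subset_of_le_one h (fun k _ => sub_nonneg.2 (hθ1 k)) (fun k _ _ => sub_le_self 1 (hθ0 k))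

/-- **Partial sums of nested coefficients.**  For `Q ⊆ {k ≤ i}`:
`Σ_{k∈Q} θ_kΠ_{k'<k}(1−θ_{k'}) ≥ Π_{k<i, k∉Q}(1−θ_k) · (1 − Π_{k∈Q}(1−θ_k))`. [folklore] -/
theorem nestedCoeff_partial_lower [LinearOrder ι] (θ : ι → ℝ) (hθ0 : ∀ i, 0 ≤ θ i) (hθ1 : ∀ i, θ i ≤ 1) (i : ι) (Q : Finset ι)
    (hQ : ∀ k ∈ Q, k ≤ i) :
    (∏ k ∈ univ.filter (fun k => k < i ∧ k ∉ Q), (1 - θ k)) * (1 - ∏ k ∈ Q, (1 - θ k)) ≤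
      ∑ k ∈ Q, θ k * ∏ k' ∈ univ.filter (· < k), (1 - θ k') := by
  have hG0 : 0 ≤ ∏ k ∈ univ.filter (fun k => k < i ∧ k ∉ Q), (1 - θ k) := prod_nonneg fun k _ => sub_nonneg.2 (hθ1 k)
  -- telescoping inside `Q`
  have htel : 1 - ∏ k ∈ Q, (1 - θ k) = ∑ k ∈ Q, θ k * ∏ k' ∈ Q.filter (· < k), (1 - θ k') := by
    rw [Finset.prod_one_sub_ordered]; ring
  rw [htel, Finset.mul_sum]
  refine Finset.sum_le_sum fun k hk => ?_
  -- `Π_{k'<k} ≥ G · Π_{k'<k, k'∈Q}`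
  have hsub : univ.filter (· < k) ⊆ univ.filter (fun k' => k' < i ∧ k' ∉ Q) ∪ Q.filter (· < k) := by
    intro k' hk'
    rw [mem_filter] at hk'
    rw [mem_union, mem_filter, mem_filter]
    by_cases hk'Q : k' ∈ Q
    · exact Or.inr ⟨hk'Q, hk'.2⟩
    · exact Or.inl ⟨mem_univ _, lt_of_lt_of_le hk'.2 (hQ k hk), hk'Q⟩
  have hdisj : Disjoint (univ.filter (fun k' => k' < i ∧ k' ∉ Q)) (Q.filter (· < k)) := by
    rw [Finset.disjoint_left]
    intro k' h1 h2
    rw [mem_filter] at h1 h2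
    exact h1.2.2 h2.1
  have hle := prod_one_sub_anti θ hθ0 hθ1 hsub
  rw [Finset.prod_union hdisj] at hle
  calc (∏ k ∈ univ.filter (fun k => k < i ∧ k ∉ Q), (1 - θ k)) * (θ k * ∏ k' ∈ Q.filter (· < k), (1 - θ k'))
      = θ k * ((∏ k ∈ univ.filter (fun k => k < i ∧ k ∉ Q), (1 - θ k)) * ∏ k' ∈ Q.filter (· < k), (1 - θ k')) := by ring
    _ ≤ θ k * ∏ k' ∈ univ.filter (· < k), (1 - θ k') := mul_le_mul_of_nonneg_left hle (hθ0 k)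

/-- **Sufficiency of the charging scheme (division-free).**  `i ∈ Q ⊆ {k ≤ i}` with `Q ∖ {i} = {k ∈ M : k < i}`, `i ∉ M`, `i ∈ N`,
`N ∖ {i} ⊆ M`.  Then `θ_iΠ_{k≠i}(1−θ_k) ≤ c_iΠ_N(1−θ) + (Σ_{k∈Q}c_k)·θ_iΠ_M(1−θ)` and `θ_iΠ_{k≠i}(1−θ_k) ≤ (Σ_{k∈Q}c_k)·Π_M(1−θ)`. [folklore] -/
theorem forest_sufficiency [LinearOrder ι] (θ : ι → ℝ) (hθ0 : ∀ i, 0 ≤ θ i) (hθ1 : ∀ i, θ i ≤ 1) (i : ι) (Q M N : Finset ι)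
    (hQle : ∀ k ∈ Q, k ≤ i) (hiQ : i ∈ Q) (hQM : ∀ k, k ∈ Q.erase i ↔ (k < i ∧ k ∈ M)) (hiM : i ∉ M)
    (hiN : i ∈ N) (hNM : N.erase i ⊆ M) :
    θ i * ∏ k ∈ univ \ {i}, (1 - θ k) ≤
        (θ i * ∏ k ∈ univ.filter (· < i), (1 - θ k)) * ∏ k ∈ N, (1 - θ k) +
          (∑ k ∈ Q, θ k * ∏ k' ∈ univ.filter (· < k), (1 - θ k')) * (θ i * ∏ k ∈ M, (1 - θ k)) ∧
      θ i * ∏ k ∈ univ \ {i}, (1 - θ k) ≤ (∑ k ∈ Q, θ k * ∏ k' ∈ univ.filter (· < k), (1 - θ k')) * ∏ k ∈ M, (1 - θ k) := by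
  set Gi : ℝ := ∏ k ∈ univ.filter (fun k => k < i ∧ k ∉ Q), (1 - θ k) with hGi
  have hGinn : 0 ≤ Gi := prod_nonneg fun k _ => sub_nonneg.2 (hθ1 k)
  -- (L3) `Σ_Q c ≥ Gi (1 − Π_Q)`
  have hL3 : Gi * (1 - ∏ k ∈ Q, (1 - θ k)) ≤ ∑ k ∈ Q, θ k * ∏ k' ∈ univ.filter (· < k), (1 - θ k') :=
    nestedCoeff_partial_lower θ hθ0 hθ1 i Q hQle
  -- (L4) `Π_{<i} = Gi · Π_{Q ∖ i}`
  have hL4 : ∏ k ∈ univ.filter (· < i), (1 - θ k) = Gi * ∏ k ∈ Q.erase i, (1 - θ k) := by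
    have hunion : univ.filter (· < i) = univ.filter (fun k => k < i ∧ k ∉ Q) ∪ Q.erase i := by
      ext k
      rw [mem_union, hQM]
      simp only [mem_filter, mem_univ, true_and]
      constructor
      · intro h
        by_cases hkQ : k ∈ Q
        · exact Or.inr ((hQM k).1 (mem_erase.2 ⟨ne_of_lt h, hkQ⟩))
        · exact Or.inl ⟨h, hkQ⟩
      · rintro (h | h)
        · exact h.1
        · exact h.1
    have hdisj : Disjoint (univ.filter (fun k => k < i ∧ k ∉ Q)) (Q.erase i) := by
      rw [Finset.disjoint_left]
      intro k h1 h2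
      exact (mem_filter.1 h1).2.2 (Finset.mem_of_mem_erase h2)
    rw [hunion, prod_union hdisj]
  -- (L5)
  have hL5 : ∏ k ∈ Q, (1 - θ k) = (1 - θ i) * ∏ k ∈ Q.erase i, (1 - θ k) :=
    (Finset.mul_prod_erase Q (fun k => 1 - θ k) hiQ).symm
  -- (L6) `Π_M = Π_{Q ∖ i} · Π_{M, > i}`
  have hL6 : ∏ k ∈ M, (1 - θ k) = (∏ k ∈ Q.erase i, (1 - θ k)) * ∏ k ∈ M.filter (fun k => i < k), (1 - θ k) := by
    have hunion : M = Q.erase i ∪ M.filter (fun k => i < k) := by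
      ext k
      rw [mem_union, hQM, mem_filter]
      constructor
      · intro hk
        have hne : k ≠ i := fun h => hiM (h ▸ hk)
        rcases lt_or_gt_of_ne hne with h | h
        · exact Or.inl ⟨h, hk⟩
        · exact Or.inr ⟨hk, h⟩
      · rintro (⟨-, hk⟩ | ⟨hk, -⟩)
        · exact hk
        · exact hk
    have hdisj : Disjoint (Q.erase i) (M.filter (fun k => i < k)) := by
      rw [Finset.disjoint_left]
      intro k h1 h2
      rw [hQM] at h1
      exact lt_asymm h1.1 (mem_filter.1 h2).2
    calc ∏ k ∈ M, (1 - θ k) = ∏ k ∈ Q.erase i ∪ M.filter (fun k => i < k), (1 - θ k) :=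
          Finset.prod_congr hunion (fun _ _ => rfl)
      _ = _ := prod_union hdisj
  -- (L8) `Π_{M, > i} ≥ Π_{> i}` and `W {i} = θ i Π_{<i} Π_{>i}`
  have hL8 : ∏ k ∈ univ.filter (fun k => i < k), (1 - θ k) ≤ ∏ k ∈ M.filter (fun k => i < k), (1 - θ k) :=
    prod_one_sub_anti θ hθ0 hθ1 (fun k hk => mem_filter.2 ⟨mem_univ _, (mem_filter.1 hk).2⟩)
  have hWsplit : θ i * ∏ k ∈ univ \ {i}, (1 - θ k) =
      θ i * ((∏ k ∈ univ.filter (· < i), (1 - θ k)) * ∏ k ∈ univ.filter (fun k => i < k), (1 - θ k)) := by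
    congr 1
    have hunion : univ \ {i} = univ.filter (· < i) ∪ univ.filter (fun k => i < k) := by
      ext k
      rw [mem_sdiff, mem_singleton, mem_union, mem_filter, mem_filter]
      constructor
      · rintro ⟨-, hne⟩
        rcases lt_or_gt_of_ne hne with h | h
        · exact Or.inl ⟨mem_univ _, h⟩
        · exact Or.inr ⟨mem_univ _, h⟩
      · rintro (⟨-, h⟩ | ⟨-, h⟩)
        · exact ⟨mem_univ _, ne_of_lt h⟩
        · exact ⟨mem_univ _, (ne_of_lt h).symm⟩
    have hdisj : Disjoint (univ.filter (· < i)) (univ.filter (fun k => i < k)) := by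
      rw [Finset.disjoint_left]
      intro k h1 h2
      exact lt_asymm (mem_filter.1 h1).2 (mem_filter.1 h2).2
    rw [hunion, prod_union hdisj]
  -- the common lower bound `θ i · Gi · X · Y`
  set X : ℝ := ∏ k ∈ Q.erase i, (1 - θ k) with hX
  set Y : ℝ := ∏ k ∈ M.filter (fun k => i < k), (1 - θ k) with hY
  have hXnn : 0 ≤ X := prod_nonneg fun k _ => sub_nonneg.2 (hθ1 k)
  have hX1 : X ≤ 1 := prod_le_one (fun k _ => sub_nonneg.2 (hθ1 k)) (fun k _ => sub_le_self 1 (hθ0 k))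
  have hYnn : 0 ≤ Y := prod_nonneg fun k _ => sub_nonneg.2 (hθ1 k)
  have hcore : θ i * ∏ k ∈ univ \ {i}, (1 - θ k) ≤ θ i * Gi * X * Y := by
    rw [hWsplit, hL4]
    have h1 : 0 ≤ θ i * (Gi * X) := mul_nonneg (hθ0 i) (mul_nonneg hGinn hXnn)
    calc θ i * (Gi * X * ∏ k ∈ univ.filter (fun k => i < k), (1 - θ k))
        = θ i * (Gi * X) * ∏ k ∈ univ.filter (fun k => i < k), (1 - θ k) := by ring
      _ ≤ θ i * (Gi * X) * Y := mul_le_mul_of_nonneg_left hL8 h1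
      _ = θ i * Gi * X * Y := by ring
  have hPM : ∏ k ∈ M, (1 - θ k) = X * Y := hL6
  have hsumQ : Gi * (1 - (1 - θ i) * X) ≤ ∑ k ∈ Q, θ k * ∏ k' ∈ univ.filter (· < k), (1 - θ k') := by
    rw [hL5] at hL3; exact hL3
  constructor
  · -- type A
    have hL7 : (1 - θ i) * ∏ k ∈ M, (1 - θ k) ≤ ∏ k ∈ N, (1 - θ k) := by
      rw [← Finset.mul_prod_erase N (fun k => 1 - θ k) hiN]
      exact mul_le_mul_of_nonneg_left (prod_one_sub_anti θ hθ0 hθ1 hNM) (sub_nonneg.2 (hθ1 i))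
    have hcinn : 0 ≤ θ i * ∏ k ∈ univ.filter (· < i), (1 - θ k) :=
      mul_nonneg (hθ0 i) (prod_nonneg fun k _ => sub_nonneg.2 (hθ1 k))
    have hstep1 : (θ i * ∏ k ∈ univ.filter (· < i), (1 - θ k)) * ((1 - θ i) * ∏ k ∈ M, (1 - θ k)) ≤
        (θ i * ∏ k ∈ univ.filter (· < i), (1 - θ k)) * ∏ k ∈ N, (1 - θ k) := mul_le_mul_of_nonneg_left hL7 hcinn
    have hstep2 : Gi * (1 - (1 - θ i) * X) * (θ i * ∏ k ∈ M, (1 - θ k)) ≤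
        (∑ k ∈ Q, θ k * ∏ k' ∈ univ.filter (· < k), (1 - θ k')) * (θ i * ∏ k ∈ M, (1 - θ k)) :=
      mul_le_mul_of_nonneg_right hsumQ (mul_nonneg (hθ0 i) (prod_nonneg fun k _ => sub_nonneg.2 (hθ1 k)))
    refine le_trans hcore ?_
    calc θ i * Gi * X * Y
        = (θ i * ∏ k ∈ univ.filter (· < i), (1 - θ k)) * ((1 - θ i) * ∏ k ∈ M, (1 - θ k)) +
            Gi * (1 - (1 - θ i) * X) * (θ i * ∏ k ∈ M, (1 - θ k)) := by rw [hL4, hPM]; ring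
      _ ≤ _ := add_le_add hstep1 hstep2
  · -- type B
    have hstep : Gi * (1 - (1 - θ i) * X) * ∏ k ∈ M, (1 - θ k) ≤
        (∑ k ∈ Q, θ k * ∏ k' ∈ univ.filter (· < k), (1 - θ k')) * ∏ k ∈ M, (1 - θ k) :=
      mul_le_mul_of_nonneg_right hsumQ (prod_nonneg fun k _ => sub_nonneg.2 (hθ1 k))
    have hθX : θ i ≤ 1 - (1 - θ i) * X := by nlinarith [hθ0 i, hθ1 i, hXnn, hX1]
    refine le_trans hcore ?_
    calc θ i * Gi * X * Y = Gi * θ i * (X * Y) := by ring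
      _ ≤ Gi * (1 - (1 - θ i) * X) * (X * Y) := by
          have := mul_le_mul_of_nonneg_left hθX hGinn
          exact mul_le_mul_of_nonneg_right this (mul_nonneg hXnn hYnn)
      _ = Gi * (1 - (1 - θ i) * X) * ∏ k ∈ M, (1 - θ k) := by rw [hPM]
      _ ≤ _ := hstep

end StarSet

end Summit.CriticalPhenomena.PercolationContinuityZ3.Theorems
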